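import Summits.CriticalPhenomena.PercolationContinuityZ3.Theorems.PercNearOneGluingNoHeavyLowerTailSahiHubTwoLevel
import Summits.CriticalPhenomena.PercolationContinuityZ3.Theorems.PercNearOneGluingNoHeavyLowerTailSahiSharedTwoPoint
import Mathlib.Tactic.Linarith
import Mathlib.Tactic.Positivity
import HarnessLib

/-!
# `NoHeavyLowerTail` (crux stmt-CriticalPhenomena-4575), P2 — T₁(|C|=1) AS A STATEMENT ABOUT THE HUB TWO-LEVEL FORM:
# `E₃(s) = (1−s)²A₀ + s(1−s)·TL + s²A₁`, and Kahn's `C₃` on T₁(|C|=1) from `TL ≥ 0` / from `D₀ ≥ 0` / from a ratio certificate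

Memo `FROM-prim-masterthm-p2-g27-POLARISED-RATIO.md` §0/§2, SAHI-ROUTE.md §4.51 (seat `prim-masterthm-p2`, gen 27; `--supports stmt-CriticalPhenomena-4575`).
No `sorry`, no named facts, standard axioms.  Companion of `…SahiHubTwoLevel` (the identities and `TL ≥ D₀`) and of `…SahiSharedTwoPoint` (THEOREM A).

SETTING.  T₁(|C|=1) is Kahn's `C₃` for the triple `f(z,c,a), g(z,c,b), h(z,a,b)` (`f, g` share exactly the hub coin `z` and the coin `c`;
`h` ignores `c`).  Here: `α, β` finite distributive lattices with FKG probability weights `wA, wB` (the blocks `A, B`), `Z = C = Fin 2` with weights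
`wZ` (`Σ = 1`) and `wc` (`wc 0 + wc 1 = 1`), product weight `wA ⊗ wB ⊗ (wZ ⊗ wc)` on `α × β × (Fin 2 × Fin 2)`; data as in `…SahiHubTwoLevel`:
`f i z a` (`i` = c-level), `g j z b`, `h z a b`, nonnegative, monotone in every argument, nested in the c-level.

* `sahiE_T1C1_eq` — **THE c-POLARISATION**: `E₃(f,g,h) = (wc 0)²·A₀ + (wc 0)(wc 1)·TL + (wc 1)²·A₁` where `A_i = E₃(f_i,g_i,h)` on `α × β × Fin 2`
  (`Asec`; a THEOREM-A triple) and `TL = SahiHubTwoLevel.twoLevel` (the hub two-level form; needs only `Σ wA = Σ wB = 1`, `wc 0 + wc 1 = 1`).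
* `sahiE_three_nonneg_T1C1_of_twoLevel_nonneg` — **`TL ≥ 0 ⟹ E₃ ≥ 0`** (THEOREM A `SahiSharedTwoPoint.sahiE_three_nonneg_sharedTwoPoint` for `A₀, A₁`).
* `sahiE_three_nonneg_T1C1_of_Dzero_nonneg` — **THE `D₀` FACE**: Kahn's `C₃` on T₁(|C|=1) whenever
  `D₀ = Cov_z(ḡ₀,e₀) + Cov_z(ḡ₁,e₁) + (ḡ₁−ḡ₀)(Cov(f₁,h) − Cov(f₀,h)) ≥ 0` (`SahiHubTwoLevel.twoLevel_ge_Dzero`; ≈ 85 % of sampled cells).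
* `sahiE_three_nonneg_T1C1_of_ratio` — **THE CERTIFICATE FORM**: Kahn's `C₃` on T₁(|C|=1) whenever some ratio `ρ ∈ [0,1]^{2×2}` has
  `Φ_B(ρ)(b) ≥ 0` at every fibre and `DELTA(ρ) ≥ 0` (`SahiHubTwoLevel.twoLevel_nonneg_of_ratio`; memo §3–§4: such a `ρ` exists in every one of
  ≈ 8 000 sampled cells — the open finite-dimensional statement that now carries T₁(|C|=1)).
HONEST LABEL: faces / certificate frame of T₁(|C|=1); `C₃`, T₁, T₁(|C|=1) OPEN. [this work]
-/

noncomputable section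

open scoped Classical

namespace Summit.CriticalPhenomena.PercolationContinuityZ3.Theorems

namespace SahiHubTwoLevel

open Finset Literature.Combinatorics.Sahi2008

section Link
/-! ### The link with `E₃` of the T₁(|C|=1) triple: `E₃(s) = (1−s)²A₀ + s(1−s)·TL + s²A₁` -/

variable {α β : Type} [Fintype α] [Fintype β]
  {wA : α → ℝ} {wB : β → ℝ} {wZ wc : Fin 2 → ℝ} {f : Fin 2 → Fin 2 → α → ℝ} {g : Fin 2 → Fin 2 → β → ℝ} {h : Fin 2 → α → β → ℝ}

variable (wA wB wZ f g h) in
/-- `A_i = E₃(f_i, g_i, h)`: Sahi's functional of the c-section-`i` triple `(f_i(z,a), g_i(z,b), h(z,a,b))` on `α × β × Fin 2`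
(a THEOREM-A triple: the first two members share only the hub `z`). [this work] -/
def Asec (i : Fin 2) : ℝ :=
  sahiE (fun q : α × β × Fin 2 => wA q.1 * wB q.2.1 * wZ q.2.2) 3
    ![fun q => f i q.2.2 q.1, fun q => g i q.2.2 q.2.1, fun q => h q.2.2 q.1 q.2.1]

/-- **THE c-POLARISATION OF `E₃`.**  For the T₁(|C|=1) triple `f(z,c,a), g(z,c,b), h(z,a,b)` on `α × β × (Z × C)` with the product weight
`wA ⊗ wB ⊗ (wZ ⊗ wc)` (`wc 0 + wc 1 = 1` the law of the coin `c`, `Σ wA = Σ wB = 1`):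
`E₃ = (wc 0)²·A₀ + (wc 0)(wc 1)·TL + (wc 1)²·A₁` — the middle Bernstein coefficient of `s ↦ E₃` is half the hub two-level form. [this work] -/
theorem sahiE_T1C1_eq (hA1 : ∑ a, wA a = 1) (hB1 : ∑ b, wB b = 1) (hc : wc 0 + wc 1 = 1) :
    sahiE (fun q : α × β × (Fin 2 × Fin 2) => wA q.1 * wB q.2.1 * (wZ q.2.2.1 * wc q.2.2.2)) 3
        ![fun q => f q.2.2.2 q.2.2.1 q.1, fun q => g q.2.2.2 q.2.2.1 q.2.1, fun q => h q.2.2.1 q.1 q.2.1]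
      = wc 0 ^ 2 * Asec wA wB wZ f g h 0 + wc 0 * wc 1 * twoLevel wA wB wZ f g h + wc 1 ^ 2 * Asec wA wB wZ f g h 1 := by
  obtain ⟨eFGH, eFG, eFH, eF, eGH, eG, eH⟩ :=
    SahiSharedTwoPoint.expectations (wA := wA) (wB := wB) (wC := fun c : Fin 2 × Fin 2 => wZ c.1 * wc c.2)
      (f := fun c a => f c.2 c.1 a) (g := fun c b => g c.2 c.1 b) (h := fun c a b => h c.1 a b) hA1 hB1
  have e2 := fun i : Fin 2 => SahiSharedTwoPoint.expectations (wA := wA) (wB := wB) (wC := wZ)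
      (f := f i) (g := g i) (h := h) hA1 hB1
  obtain ⟨aFGH, aFG, aFH, aF, aGH, aG, aH⟩ := e2 0
  obtain ⟨bFGH, bFG, bFH, bF, bGH, bG, -⟩ := e2 1
  have hG4 : SahiSharedTwoPoint.Gbar wB (fun c : Fin 2 × Fin 2 => wZ c.1 * wc c.2) (fun c b => g c.2 c.1 b)
      = ∑ c : Fin 2 × Fin 2, (wZ c.1 * wc c.2) * gm wB g c.2 c.1 := by
    unfold SahiSharedTwoPoint.Gbar SahiSharedTwoPoint.GG gm
    exact SahiTriangleClassT.swap_bc wB _ (fun b (c : Fin 2 × Fin 2) => g c.2 c.1 b)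
  have hG2 : ∀ i : Fin 2, SahiSharedTwoPoint.Gbar wB wZ (g i) = ∑ z, wZ z * gm wB g i z := fun i => by
    unfold SahiSharedTwoPoint.Gbar SahiSharedTwoPoint.GG gm
    exact SahiTriangleClassT.swap_bc wB wZ (fun b z => g i z b)
  unfold Asec
  rw [sahiE_three, sahiE_three, sahiE_three]
  rw [eFGH, eFG, eFH, eF, eGH, eG, eH, aFGH, aFG, aFH, aF, aGH, aG, aH, bFGH, bFG, bFH, bF, bGH, bG, hG4, hG2 0, hG2 1]
  simp only [SahiSharedTwoPoint.EH, SahiSharedTwoPoint.EF, SahiSharedTwoPoint.Ybar, SahiSharedTwoPoint.Hbar, SahiSharedTwoPoint.Y,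
    SahiSharedTwoPoint.FC, SahiSharedTwoPoint.HH, SahiSharedTwoPoint.GC, twoLevel, Sgy, Sgh, Ybar, Ysl, Hsl, Fm, gm, fbar, gbar, hbar, Hb,
    Fintype.sum_prod_type, Fin.sum_univ_two]
  have hc1 : wc 1 = 1 - wc 0 := by linarith
  rw [hc1]
  ring

set_option maxHeartbeats 400000 in
/-- **T₁(|C|=1) FROM THE HUB TWO-LEVEL FORM.**  If `TL ≥ 0` then `E₃(f,g,h) ≥ 0` for the T₁(|C|=1) triple on `α × β × (Z × C)`
(`A₀, A₁ ≥ 0` by THEOREM A `SahiSharedTwoPoint.sahiE_three_nonneg_sharedTwoPoint` with `γ = Fin 2`). [this work] -/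
theorem sahiE_three_nonneg_T1C1_of_twoLevel_nonneg [DistribLattice α] [DistribLattice β] (hA : IsFKGMeasure wA) (hB : IsFKGMeasure wB)
    (hZ0 : ∀ z, 0 ≤ wZ z) (hZ1 : ∑ z, wZ z = 1) (hc0 : ∀ c, 0 ≤ wc c) (hc1 : wc 0 + wc 1 = 1)
    (hf0 : ∀ i z a, 0 ≤ f i z a) (hfa : ∀ i z, Monotone (f i z)) (hfz : ∀ i a, Monotone (fun z => f i z a))
    (hg0 : ∀ j z b, 0 ≤ g j z b) (hgb : ∀ j z, Monotone (g j z)) (hgz : ∀ j b, Monotone (fun z => g j z b))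
    (hh0 : ∀ z a b, 0 ≤ h z a b) (hhz : ∀ a b, Monotone (fun z => h z a b)) (hha : ∀ z b, Monotone (fun a => h z a b))
    (hhb : ∀ z a, Monotone (h z a)) (hTL : 0 ≤ twoLevel wA wB wZ f g h) :
    0 ≤ sahiE (fun q : α × β × (Fin 2 × Fin 2) => wA q.1 * wB q.2.1 * (wZ q.2.2.1 * wc q.2.2.2)) 3
        ![fun q => f q.2.2.2 q.2.2.1 q.1, fun q => g q.2.2.2 q.2.2.1 q.2.1, fun q => h q.2.2.1 q.1 q.2.1] := by
  rw [sahiE_T1C1_eq hA.sum_eq_one hB.sum_eq_one hc1]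
  have hAi : ∀ i : Fin 2, 0 ≤ Asec wA wB wZ f g h i := fun i => by
    unfold Asec
    exact SahiSharedTwoPoint.sahiE_three_nonneg_sharedTwoPoint (c₀ := (0 : Fin 2)) (c₁ := 1) hA hB hZ0 hZ1 (by decide)
      (fun c h0 h1 => by fin_cases c <;> simp_all) (hf0 i) (hfa i) (hfz i) (hg0 i) (hgb i) (hgz i) hh0 hhz hha hhb
  have h0 := hAi 0; have h1 := hAi 1
  have := hc0 0; have := hc0 1
  positivity

/-- **THE `D₀` FACE OF T₁(|C|=1).**  Kahn's `C₃` holds for `f(z,c,a), g(z,c,b), h(z,a,b)` (any c-bias, FKG blocks `α, β`) whenever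
`D₀ = Cov_z(ḡ₀,e₀) + Cov_z(ḡ₁,e₁) + (ḡ₁−ḡ₀)(Cov(f₁,h)−Cov(f₀,h)) ≥ 0` (memo §2(d); `twoLevel_ge_Dzero`). [this work] -/
theorem sahiE_three_nonneg_T1C1_of_Dzero_nonneg [DistribLattice α] [DistribLattice β] (hA : IsFKGMeasure wA) (hB : IsFKGMeasure wB)
    (hZ0 : ∀ z, 0 ≤ wZ z) (hZ1 : ∑ z, wZ z = 1) (hc0 : ∀ c, 0 ≤ wc c) (hc1 : wc 0 + wc 1 = 1)
    (hf0 : ∀ i z a, 0 ≤ f i z a) (hfa : ∀ i z, Monotone (f i z)) (hfz : ∀ i a, Monotone (fun z => f i z a))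
    (hfi : ∀ z a, f 0 z a ≤ f 1 z a)
    (hg0 : ∀ j z b, 0 ≤ g j z b) (hgb : ∀ j z, Monotone (g j z)) (hgz : ∀ j b, Monotone (fun z => g j z b))
    (hgi : ∀ z b, g 0 z b ≤ g 1 z b)
    (hh0 : ∀ z a b, 0 ≤ h z a b) (hhz : ∀ a b, Monotone (fun z => h z a b)) (hha : ∀ z b, Monotone (fun a => h z a b))
    (hhb : ∀ z a, Monotone (h z a)) (hD : 0 ≤ Dzero wA wB wZ f g h) :
    0 ≤ sahiE (fun q : α × β × (Fin 2 × Fin 2) => wA q.1 * wB q.2.1 * (wZ q.2.2.1 * wc q.2.2.2)) 3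
        ![fun q => f q.2.2.2 q.2.2.1 q.1, fun q => g q.2.2.2 q.2.2.1 q.2.1, fun q => h q.2.2.1 q.1 q.2.1] := by
  have hZ01 : wZ 0 + wZ 1 = 1 := by have := hZ1; rw [Fin.sum_univ_two] at this; exact this
  have hTL := twoLevel_ge_Dzero hA hB (hZ0 0) (hZ0 1) hZ01 hf0 hfa (fun i a => hfz i a (by decide)) hfi hg0 hgb
    (fun j b => hgz j b (by decide)) hgi hh0 hha hhb (fun a b => hhz a b (by decide))
  exact sahiE_three_nonneg_T1C1_of_twoLevel_nonneg hA hB hZ0 hZ1 hc0 hc1 hf0 hfa hfz hg0 hgb hgz hh0 hhz hha hhb (le_trans hD hTL)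

/-- **THE CERTIFICATE FORM OF T₁(|C|=1).**  If some ratio `ρ ∈ [0,1]^{2×2}` has `Φ_B(ρ)(b) ≥ 0` at every fibre and `DELTA(ρ) ≥ 0`, then Kahn's `C₃`
holds for the T₁(|C|=1) triple at every c-bias (memo §3–§4: such a `ρ` exists in every sampled cell). [this work] -/
theorem sahiE_three_nonneg_T1C1_of_ratio [DistribLattice α] [DistribLattice β] (hA : IsFKGMeasure wA) (hB : IsFKGMeasure wB)
    (hZ0 : ∀ z, 0 ≤ wZ z) (hZ1 : ∑ z, wZ z = 1) (hc0 : ∀ c, 0 ≤ wc c) (hc1 : wc 0 + wc 1 = 1)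
    (hf0 : ∀ i z a, 0 ≤ f i z a) (hfa : ∀ i z, Monotone (f i z)) (hfz : ∀ i a, Monotone (fun z => f i z a))
    (hg0 : ∀ j z b, 0 ≤ g j z b) (hgb : ∀ j z, Monotone (g j z)) (hgz : ∀ j b, Monotone (fun z => g j z b))
    (hh0 : ∀ z a b, 0 ≤ h z a b) (hhz : ∀ a b, Monotone (fun z => h z a b)) (hha : ∀ z b, Monotone (fun a => h z a b))
    (hhb : ∀ z a, Monotone (h z a)) {ρ : Fin 2 → Fin 2 → ℝ} (hρ0 : ∀ i z, 0 ≤ ρ i z) (hρ1 : ∀ i z, ρ i z ≤ 1)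
    (hPhi : ∀ b, 0 ≤ PhiB wA wZ f g h ρ b) (hDelta : 0 ≤ DeltaR wA wB wZ f g h ρ) :
    0 ≤ sahiE (fun q : α × β × (Fin 2 × Fin 2) => wA q.1 * wB q.2.1 * (wZ q.2.2.1 * wc q.2.2.2)) 3
        ![fun q => f q.2.2.2 q.2.2.1 q.1, fun q => g q.2.2.2 q.2.2.1 q.2.1, fun q => h q.2.2.1 q.1 q.2.1] :=
  sahiE_three_nonneg_T1C1_of_twoLevel_nonneg hA hB hZ0 hZ1 hc0 hc1 hf0 hfa hfz hg0 hgb hgz hh0 hhz hha hhb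
    (twoLevel_nonneg_of_ratio (f := f) hB hA.nonneg hZ0 hf0 hg0 hgb hh0 hhb hρ0 hρ1 hPhi hDelta)

end Link

end SahiHubTwoLevel

end Summit.CriticalPhenomena.PercolationContinuityZ3.Theorems
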